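import Summits.AnomalousDissipation.AnomalousDissipation.Theorems.SawtoothPulseCascadeK1LocalisedCascadeOscPhase4
import Summits.AnomalousDissipation.AnomalousDissipation.Theorems.SawtoothPulseCascadeK1LocalisedCascadeOscPhase5
import Summits.AnomalousDissipation.AnomalousDissipation.Theorems.SawtoothPulseCascadeK1LocalisedCascadeOscPhase6
import Summits.AnomalousDissipation.AnomalousDissipation.Theorems.SawtoothPulseCascadeK1LocalisedCascadeOscPhase7
import Summits.AnomalousDissipation.AnomalousDissipation.Theorems.SawtoothPulseCascadeK1LocalisedCascadeOscPhase8
import Summits.AnomalousDissipation.AnomalousDissipation.Theorems.SawtoothPulseCascadeK1LocalisedCascadeOscPhase9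
import Summits.AnomalousDissipation.AnomalousDissipation.Theorems.SawtoothPulseCascadeK1LocalisedCascadeOscPhase10
import Summits.AnomalousDissipation.AnomalousDissipation.Theorems.SawtoothPulseCascadeK1LocalisedCascadeOscPhase11

/-!
# K1loc — THE FAT OSCILLATORY SEGMENT, CERTIFIED (phases 4 … 11: K_4 = 500000 = 800·25² → K_12 = 800·25¹⁰)

Prover lane on the crux `K1LocalisedCascade` (stmt-AnomalousDissipation-19491), route `SawtoothPulseCascade`
(S-B/S-C assembly seat; the LEDGER ASSEMBLY, numeric layer, Osc grade).  The certified phases `…OscPhase4 … OscPhase11`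
(`resolved_step_osc_phase⟨j⟩`: `E_{j+1} ≤ E_j + (e⁰_j + 2w^T_j·o_j)`, `√O_{j+1} ≤ o_{j+1}`) chained from the phase-4 input
`o ≥ √O_4(K_4)` (the off-cone amplitude left by the phase-3 CT step, ad-k1loc-p3), `E_j = S_j(K_j) + O_j(K_j)` (strip + off-cone class
`(1,4)` of the inviscid iterate `a_j` at `K_j = 800·25^{j−2}`), `γ = 8`, `0 < δ₀ ≤ 2⁻⁵⁰`:
* `fat_segment_osc_le_10`: `E_10 ≤ E_4 + (0.1452 + 0.2488·o)`, `√O_10(K_10) ≤ 0.0054`;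
* `fat_segment_osc_le_11`: `E_11 ≤ E_4 + (0.1453 + 0.2488·o)`, `√O_11(K_11) ≤ 0.0036`;
* `fat_segment_osc_le_12`: `E_12 ≤ E_4 + (0.1454 + 0.2488·o)`, `√O_12(K_12) ≤ 0.0023`
— the candidate hand-over phases to the thin tail (ratio `γ² − 3 = 61` per phase, off-cone widened to the class `16|k₀| ≤ 125|k₁|`
`⊇ {13/10·|k₀| < 8|k₁|}` of the closer; the widening windows live at the last fat phase).
Budget line (A23-14 revised, this seat): `E_2 ≤ 0.05` (StartBox + CT phase-1 dischargers) `+ (e_2 + e_3 ≤ 0.17)` (CT input-free)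
`+ (0.1454 + 0.249·o_4)` (this file) `+` junction `+` thin tail `< ‖datum‖² = 1/2`.
No definitions; no statement about the crux. [cite: Grafakos2014, Prop. 3.1.2 (5), Prop. 3.2.7 (3), §3.1.3] [problem: turb]
-/

-- `Summit.<Summit>.<Problem>`: single-conjunct summit, the duplicate namespace segment is deliberate.
set_option linter.dupNamespace false

noncomputable section

namespace Summit.AnomalousDissipation.AnomalousDissipation.Theorems.SawtoothPulseCascade.K1Window

open MeasureTheory Set Filter Topology UnitAddTorus Function Complex Metric
open scoped Real ENNReal
open Literature.Analysis Literature.Analysis.FunctionSpaces Literature.Analysis.FunctionSpaces.Torus Literature.Analysis.FluidPDE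
open Literature.Analysis.FluidPDE.ShearStage
open Literature.Analysis.FluidPDE.SawtoothCascade Literature.Analysis.FluidPDE.SawtoothCascade.CascadeParams

section Cascade

variable (P : CascadeParams)

set_option maxHeartbeats 400000 in
/-- **THE FAT SEGMENT UP TO PHASE 10** (see the file header): `E_10 ≤ E_4 + (0.1452 + 0.2488·o)` for every `o ≥ √O_4(K_4)`, `o ≥ 0`, and
`√O_10(K_10) ≤ 0.0054`. [cite: Grafakos2014, Prop. 3.1.2 (5), Prop. 3.2.7 (3), §3.1.3] -/
theorem fat_segment_osc_le_10 (hγ : P.γ = 8) (hδ₀ : 0 < P.δ₀) (hδ₀' : P.δ₀ ≤ (2 : ℝ)⁻¹ ^ 50) (hd : P.d = 2) (hN₀ : P.N₀ = 1)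
    (hρN : P.ρN = 2) (a b : ℕ → UnitAddTorus (Fin 2) → ℝ) (has : ∀ j, IsSmooth (a j)) (h0 : a 0 = datum)
    (hb : ∀ j, b j = a j ∘ shearMap 0 1 (amp ⟨P.U j, P.U_periodic j, P.contDiff_U (P.δ_pos hδ₀ (by rw [hd]; norm_num) j)⟩ P.γ))
    (hab : ∀ j, a (j + 1) = b j ∘ shearMap 1 0 (amp ⟨P.U j, P.U_periodic j, P.contDiff_U (P.δ_pos hδ₀ (by rw [hd]; norm_num) j)⟩ P.γ))
    {o : ℝ} (ho0 : 0 ≤ o)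
    (ho : Real.sqrt (∑' k : Fin 2 → ℤ, (if ((500000 : ℕ) : ℤ) ≤ |k 0| ∧ ((1 : ℕ) : ℤ) * |k 0| ≤ ((4 : ℕ) : ℤ) * |k 1| then (1 : ℝ) else 0) *
          ‖mFourierCoeff (fun x => (a 4 x : ℂ)) k‖ ^ 2) ≤ o) :
    ∑' k : Fin 2 → ℤ, (if |k 0| < ((122070312500000 : ℕ) : ℤ) then (1 : ℝ) else 0) * ‖mFourierCoeff (fun x => (a 10 x : ℂ)) k‖ ^ 2 +
        ∑' k : Fin 2 → ℤ, (if ((122070312500000 : ℕ) : ℤ) ≤ |k 0| ∧ ((1 : ℕ) : ℤ) * |k 0| ≤ ((4 : ℕ) : ℤ) * |k 1| then (1 : ℝ) else 0) *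
          ‖mFourierCoeff (fun x => (a 10 x : ℂ)) k‖ ^ 2 ≤
      ∑' k : Fin 2 → ℤ, (if |k 0| < ((500000 : ℕ) : ℤ) then (1 : ℝ) else 0) * ‖mFourierCoeff (fun x => (a 4 x : ℂ)) k‖ ^ 2 +
        ∑' k : Fin 2 → ℤ, (if ((500000 : ℕ) : ℤ) ≤ |k 0| ∧ ((1 : ℕ) : ℤ) * |k 0| ≤ ((4 : ℕ) : ℤ) * |k 1| then (1 : ℝ) else 0) *
          ‖mFourierCoeff (fun x => (a 4 x : ℂ)) k‖ ^ 2 + (0.1452 + 0.2488 * o) ∧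
    Real.sqrt (∑' k : Fin 2 → ℤ, (if ((122070312500000 : ℕ) : ℤ) ≤ |k 0| ∧ ((1 : ℕ) : ℤ) * |k 0| ≤ ((4 : ℕ) : ℤ) * |k 1| then (1 : ℝ) else 0) *
          ‖mFourierCoeff (fun x => (a 10 x : ℂ)) k‖ ^ 2) ≤ 0.0054 := by
  obtain ⟨h4, o5⟩ := resolved_step_osc_phase4 P hγ hδ₀ hδ₀' hd hN₀ hρN a b has h0 hb hab ho0 ho
  obtain ⟨h5, o6⟩ := resolved_step_osc_phase5 P hγ hδ₀ hδ₀' hd hN₀ hρN a b has h0 hb hab (by norm_num) o5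
  obtain ⟨h6, o7⟩ := resolved_step_osc_phase6 P hγ hδ₀ hδ₀' hd hN₀ hρN a b has h0 hb hab (by norm_num) o6
  obtain ⟨h7, o8⟩ := resolved_step_osc_phase7 P hγ hδ₀ hδ₀' hd hN₀ hρN a b has h0 hb hab (by norm_num) o7
  obtain ⟨h8, o9⟩ := resolved_step_osc_phase8 P hγ hδ₀ hδ₀' hd hN₀ hρN a b has h0 hb hab (by norm_num) o8
  obtain ⟨h9, o10⟩ := resolved_step_osc_phase9 P hγ hδ₀ hδ₀' hd hN₀ hρN a b has h0 hb hab (by norm_num) o9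
  have hnum : (0.1107 : ℝ) + (0.0139 + 0.0752 * 0.2001) + (0.0022 + 0.0256 * 0.0727) + (0.0006 + 0.0136 * 0.0291) + (0.0002 + 0.0068 * 0.0147) + (0.0001 + 0.0036 * 0.0086) ≤ 0.1452 := by norm_num
  exact ⟨by linarith [h4, h5, h6, h7, h8, h9], o10⟩

set_option maxHeartbeats 400000 in
/-- **THE FAT SEGMENT UP TO PHASE 11** (see the file header): `E_11 ≤ E_4 + (0.1453 + 0.2488·o)` for every `o ≥ √O_4(K_4)`, `o ≥ 0`, and
`√O_11(K_11) ≤ 0.0036`. [cite: Grafakos2014, Prop. 3.1.2 (5), Prop. 3.2.7 (3), §3.1.3] -/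
theorem fat_segment_osc_le_11 (hγ : P.γ = 8) (hδ₀ : 0 < P.δ₀) (hδ₀' : P.δ₀ ≤ (2 : ℝ)⁻¹ ^ 50) (hd : P.d = 2) (hN₀ : P.N₀ = 1)
    (hρN : P.ρN = 2) (a b : ℕ → UnitAddTorus (Fin 2) → ℝ) (has : ∀ j, IsSmooth (a j)) (h0 : a 0 = datum)
    (hb : ∀ j, b j = a j ∘ shearMap 0 1 (amp ⟨P.U j, P.U_periodic j, P.contDiff_U (P.δ_pos hδ₀ (by rw [hd]; norm_num) j)⟩ P.γ))
    (hab : ∀ j, a (j + 1) = b j ∘ shearMap 1 0 (amp ⟨P.U j, P.U_periodic j, P.contDiff_U (P.δ_pos hδ₀ (by rw [hd]; norm_num) j)⟩ P.γ))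
    {o : ℝ} (ho0 : 0 ≤ o)
    (ho : Real.sqrt (∑' k : Fin 2 → ℤ, (if ((500000 : ℕ) : ℤ) ≤ |k 0| ∧ ((1 : ℕ) : ℤ) * |k 0| ≤ ((4 : ℕ) : ℤ) * |k 1| then (1 : ℝ) else 0) *
          ‖mFourierCoeff (fun x => (a 4 x : ℂ)) k‖ ^ 2) ≤ o) :
    ∑' k : Fin 2 → ℤ, (if |k 0| < ((3051757812500000 : ℕ) : ℤ) then (1 : ℝ) else 0) * ‖mFourierCoeff (fun x => (a 11 x : ℂ)) k‖ ^ 2 +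
        ∑' k : Fin 2 → ℤ, (if ((3051757812500000 : ℕ) : ℤ) ≤ |k 0| ∧ ((1 : ℕ) : ℤ) * |k 0| ≤ ((4 : ℕ) : ℤ) * |k 1| then (1 : ℝ) else 0) *
          ‖mFourierCoeff (fun x => (a 11 x : ℂ)) k‖ ^ 2 ≤
      ∑' k : Fin 2 → ℤ, (if |k 0| < ((500000 : ℕ) : ℤ) then (1 : ℝ) else 0) * ‖mFourierCoeff (fun x => (a 4 x : ℂ)) k‖ ^ 2 +
        ∑' k : Fin 2 → ℤ, (if ((500000 : ℕ) : ℤ) ≤ |k 0| ∧ ((1 : ℕ) : ℤ) * |k 0| ≤ ((4 : ℕ) : ℤ) * |k 1| then (1 : ℝ) else 0) *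
          ‖mFourierCoeff (fun x => (a 4 x : ℂ)) k‖ ^ 2 + (0.1453 + 0.2488 * o) ∧
    Real.sqrt (∑' k : Fin 2 → ℤ, (if ((3051757812500000 : ℕ) : ℤ) ≤ |k 0| ∧ ((1 : ℕ) : ℤ) * |k 0| ≤ ((4 : ℕ) : ℤ) * |k 1| then (1 : ℝ) else 0) *
          ‖mFourierCoeff (fun x => (a 11 x : ℂ)) k‖ ^ 2) ≤ 0.0036 := by
  obtain ⟨h4, o5⟩ := resolved_step_osc_phase4 P hγ hδ₀ hδ₀' hd hN₀ hρN a b has h0 hb hab ho0 ho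
  obtain ⟨h5, o6⟩ := resolved_step_osc_phase5 P hγ hδ₀ hδ₀' hd hN₀ hρN a b has h0 hb hab (by norm_num) o5
  obtain ⟨h6, o7⟩ := resolved_step_osc_phase6 P hγ hδ₀ hδ₀' hd hN₀ hρN a b has h0 hb hab (by norm_num) o6
  obtain ⟨h7, o8⟩ := resolved_step_osc_phase7 P hγ hδ₀ hδ₀' hd hN₀ hρN a b has h0 hb hab (by norm_num) o7
  obtain ⟨h8, o9⟩ := resolved_step_osc_phase8 P hγ hδ₀ hδ₀' hd hN₀ hρN a b has h0 hb hab (by norm_num) o8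
  obtain ⟨h9, o10⟩ := resolved_step_osc_phase9 P hγ hδ₀ hδ₀' hd hN₀ hρN a b has h0 hb hab (by norm_num) o9
  obtain ⟨h10, o11⟩ := resolved_step_osc_phase10 P hγ hδ₀ hδ₀' hd hN₀ hρN a b has h0 hb hab (by norm_num) o10
  have hnum : (0.1107 : ℝ) + (0.0139 + 0.0752 * 0.2001) + (0.0022 + 0.0256 * 0.0727) + (0.0006 + 0.0136 * 0.0291) + (0.0002 + 0.0068 * 0.0147) + (0.0001 + 0.0036 * 0.0086) + (0.0001 + 0.002 * 0.0054) ≤ 0.1453 := by norm_num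
  exact ⟨by linarith [h4, h5, h6, h7, h8, h9, h10], o11⟩

set_option maxHeartbeats 400000 in
/-- **THE FAT SEGMENT UP TO PHASE 12** (see the file header): `E_12 ≤ E_4 + (0.1454 + 0.2488·o)` for every `o ≥ √O_4(K_4)`, `o ≥ 0`, and
`√O_12(K_12) ≤ 0.0023`. [cite: Grafakos2014, Prop. 3.1.2 (5), Prop. 3.2.7 (3), §3.1.3] -/
theorem fat_segment_osc_le_12 (hγ : P.γ = 8) (hδ₀ : 0 < P.δ₀) (hδ₀' : P.δ₀ ≤ (2 : ℝ)⁻¹ ^ 50) (hd : P.d = 2) (hN₀ : P.N₀ = 1)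
    (hρN : P.ρN = 2) (a b : ℕ → UnitAddTorus (Fin 2) → ℝ) (has : ∀ j, IsSmooth (a j)) (h0 : a 0 = datum)
    (hb : ∀ j, b j = a j ∘ shearMap 0 1 (amp ⟨P.U j, P.U_periodic j, P.contDiff_U (P.δ_pos hδ₀ (by rw [hd]; norm_num) j)⟩ P.γ))
    (hab : ∀ j, a (j + 1) = b j ∘ shearMap 1 0 (amp ⟨P.U j, P.U_periodic j, P.contDiff_U (P.δ_pos hδ₀ (by rw [hd]; norm_num) j)⟩ P.γ))
    {o : ℝ} (ho0 : 0 ≤ o)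
    (ho : Real.sqrt (∑' k : Fin 2 → ℤ, (if ((500000 : ℕ) : ℤ) ≤ |k 0| ∧ ((1 : ℕ) : ℤ) * |k 0| ≤ ((4 : ℕ) : ℤ) * |k 1| then (1 : ℝ) else 0) *
          ‖mFourierCoeff (fun x => (a 4 x : ℂ)) k‖ ^ 2) ≤ o) :
    ∑' k : Fin 2 → ℤ, (if |k 0| < ((76293945312500000 : ℕ) : ℤ) then (1 : ℝ) else 0) * ‖mFourierCoeff (fun x => (a 12 x : ℂ)) k‖ ^ 2 +
        ∑' k : Fin 2 → ℤ, (if ((76293945312500000 : ℕ) : ℤ) ≤ |k 0| ∧ ((1 : ℕ) : ℤ) * |k 0| ≤ ((4 : ℕ) : ℤ) * |k 1| then (1 : ℝ) else 0) *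
          ‖mFourierCoeff (fun x => (a 12 x : ℂ)) k‖ ^ 2 ≤
      ∑' k : Fin 2 → ℤ, (if |k 0| < ((500000 : ℕ) : ℤ) then (1 : ℝ) else 0) * ‖mFourierCoeff (fun x => (a 4 x : ℂ)) k‖ ^ 2 +
        ∑' k : Fin 2 → ℤ, (if ((500000 : ℕ) : ℤ) ≤ |k 0| ∧ ((1 : ℕ) : ℤ) * |k 0| ≤ ((4 : ℕ) : ℤ) * |k 1| then (1 : ℝ) else 0) *
          ‖mFourierCoeff (fun x => (a 4 x : ℂ)) k‖ ^ 2 + (0.1454 + 0.2488 * o) ∧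
    Real.sqrt (∑' k : Fin 2 → ℤ, (if ((76293945312500000 : ℕ) : ℤ) ≤ |k 0| ∧ ((1 : ℕ) : ℤ) * |k 0| ≤ ((4 : ℕ) : ℤ) * |k 1| then (1 : ℝ) else 0) *
          ‖mFourierCoeff (fun x => (a 12 x : ℂ)) k‖ ^ 2) ≤ 0.0023 := by
  obtain ⟨h4, o5⟩ := resolved_step_osc_phase4 P hγ hδ₀ hδ₀' hd hN₀ hρN a b has h0 hb hab ho0 ho
  obtain ⟨h5, o6⟩ := resolved_step_osc_phase5 P hγ hδ₀ hδ₀' hd hN₀ hρN a b has h0 hb hab (by norm_num) o5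
  obtain ⟨h6, o7⟩ := resolved_step_osc_phase6 P hγ hδ₀ hδ₀' hd hN₀ hρN a b has h0 hb hab (by norm_num) o6
  obtain ⟨h7, o8⟩ := resolved_step_osc_phase7 P hγ hδ₀ hδ₀' hd hN₀ hρN a b has h0 hb hab (by norm_num) o7
  obtain ⟨h8, o9⟩ := resolved_step_osc_phase8 P hγ hδ₀ hδ₀' hd hN₀ hρN a b has h0 hb hab (by norm_num) o8
  obtain ⟨h9, o10⟩ := resolved_step_osc_phase9 P hγ hδ₀ hδ₀' hd hN₀ hρN a b has h0 hb hab (by norm_num) o9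
  obtain ⟨h10, o11⟩ := resolved_step_osc_phase10 P hγ hδ₀ hδ₀' hd hN₀ hρN a b has h0 hb hab (by norm_num) o10
  obtain ⟨h11, o12⟩ := resolved_step_osc_phase11 P hγ hδ₀ hδ₀' hd hN₀ hρN a b has h0 hb hab (by norm_num) o11
  have hnum : (0.1107 : ℝ) + (0.0139 + 0.0752 * 0.2001) + (0.0022 + 0.0256 * 0.0727) + (0.0006 + 0.0136 * 0.0291) + (0.0002 + 0.0068 * 0.0147) + (0.0001 + 0.0036 * 0.0086) + (0.0001 + 0.002 * 0.0054) + (0.0001 + 0.001 * 0.0036) ≤ 0.1454 := by norm_num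
  exact ⟨by linarith [h4, h5, h6, h7, h8, h9, h10, h11], o12⟩

end Cascade

end Summit.AnomalousDissipation.AnomalousDissipation.Theorems.SawtoothPulseCascade.K1Window
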